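import Summits.QuantumFields.BalabanUV.Beta.GAN24.GaugeReadChargeProfile
import Summits.QuantumFields.BalabanUV.Beta.GAN24.GaugeReadLayerForm

/-!
# `BalabanUV.Beta.GAN24.GaugeReadChargeMass` — binder row G-an2-4 ∕ (CONV-C), CT-W «WC-TL», (Q-R) «QR-LL», the (S) row of RULING R-gan24p1-g27-1 (the OWNER
# gan24-p1 g27's R14: (S)_j = (INV)_j ∧ W-Z0 ⇒ (M0) ∧ (Π)), piece (γ) = the response (gauge-read) letter: **(M0)_γ BY BLOCK COVARIANCE — THE SLOT-SUMMED (γ)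
# CHARGE VANISHES** for every label, every slot direction, every channel and every bounded two-leg weight whose table charges are block-periodic, PROVIDED the response
# kernels are jointly block-translation covariant (both displayed hypotheses; the literal instance discharges them by road-P2's `WardResidualRotatedVertexWeighted` §4 and
# the an2-lineage translation lemmas) — the (γ) twin of road-P2's `WardResidualRotatedVertexMass.hasSum_rotatedVertex_totalCharge_comb` ((M0) for (α))
# (G-an2-4 formalisation swarm, unit `b2b-balaban-gan24-formalise-leaf-06`, gen 45; INTENT 2, sequel of `GaugeReadChargeProfile` (INTENT 1 g45)).

NOT IN PRINT; OUR BOOKKEEPING ([folklore]; the MECHANISM is NOT road-P2's (covariant weight ⇒ block sum): at a fixed label the (γ) read weights are NOT covariant (a joint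
shift moves the label); instead the slot-summed response read is the read of a BLOCK-PERIODIC profile against the label's gauge weight `ĝ_y = 𝟙_{B(y)}(· + e_κ) − 𝟙_{B(y)}`, a
backward difference, and the block sum of a backward difference of an `N`-periodic profile is ZERO — this lineage's `GaugeReadLayerForm.boxSum_sub_shift_eq_zero_of_periodic`
BY NAME, after leaf-03's finite box form `Lin4LegDivergence.tsum_mul_gaugeWt_eq_boxSum` BY NAME; all exchanges are of `tsum`s with FINITE sums).  HONEST FRAMING (cell contract,
verbatim): «discharging `BetaPertH` makes Bałaban's UV stability UNCONDITIONAL — a real constructive-QFT result; it is NOT the continuum limit and NOT the Clay problem.»  HONEST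
DEPENDENCY (verbatim): «continuum YM on T⁴ ⇐ BetaPertH ∧ nine spine estimates (0/9 proved); BetaPertH ⇐ (D1) ∧ (D4) ∧ CAP+tail; G-an2-4 gates asym, D1 and NE2/3/4.»
No cited fact, no `def`, no `def … : Prop`, 0 sorry.

SETTING: that of `GaugeReadChargeProfile` (`1 ≤ N`, `VertexFamily A N CA δ`, `LocStencil S Cs δ`, `VertexFamily M N CM δ`, `0 < δ`, label `y`, slot direction `ν`, channel
`(a, b)`, two-leg weight `|ω| ≤ B`, ω-charges `Z_ω(K) = Σ'_{(x,z)} ω(x,z)·K x z a b`, (γ) ω-charge per slot `Q_ω(y′)`), PLUS two DISPLAYED structural hypotheses: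
(COV) `A ν (y′ + s) (u + N•s) (x + N•s) r c = A ν y′ u x r c` (joint block-translation covariance of the response kernels of the multiplier slots) and
(PER) `Z_ω(S κ (u + N•s)) = Z_ω(S κ u)`, `Z_ω(M ρ (w + s)) = Z_ω(M ρ w)` (block-periodicity of the tables' ω-charges — for `Lc`-periodic `ω` and the literal tables this is
road-P2's `weightedCharge_SpureRecAt_block ∕ weightedCharge_M1At_const`).
* §1 `summable_coarseGauss` (a Gaussian centred at a fine point is summable over the COARSE lattice), `summable_slotSum_and_abs_le` (the SLOT SUM `Σ'_{y′} E y′` of a family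
  dominated by `CA·e^{−δ(‖p − N•y′‖₁ + ‖x − N•y′‖₁)}` converges and is `≤ CA·e^{−(δ∕2)‖p − x‖₁}·Σ'_{y′} e^{−(δ∕2)‖x − N•y′‖₁}`).
* §2 **`tsum_slotSummedRead_mul_eq_zero`** — THE GENERIC MECHANISM: for a scalar family `E y′ u κ₂ x` with that domination (centre `π u`), jointly covariant under
  `(y′, u, x) ↦ (y′ + s, τ_s u, x + N•s)`, and a bounded slot function `Z` with `Z (τ_s u) = Z u`:  `Σ'_u (Σ'_{y′} Σ'_x Σ_κ₂ E y′ u κ₂ x·gaugeWt N y κ₂ x)·Z u = 0`.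
* §3 **`hasSum_weightedGaugeCharge_mass_zero`**: under (COV) + (PER), `HasSum (y′ ↦ Q_ω(y′)) 0` — (M0)_γ, the `hm` socket of `SlotMomentParity.hasSum_moments_sum` for the (γ)
  piece WITH VALUE `0`; `hasSum_gaugeCharge_mass_zero` the plain currency `ω ≡ 1` (then (PER) reads `Z(S κ (u + N•s)) = Z(S κ u)`, `Z(M ρ (w + s)) = Z(M ρ w)`).
Asserts NO value of any single pair charge, NO (Π) (the (γ) slot-dipole does NOT vanish — E19: it is exactly opposite to (α)'s), NOTHING of (INV); (COV)∕(PER) DISPLAYED, not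
discharged here; 0 estimate; discharges NOTHING of (S) beyond the (γ) summand of (M0) ∕ (Q-R) ∕ (LT) ∕ (Q-L) ∕ (C) ∕ «T2Shape» ∕ «T2Drift» ∕ (hW, hWall); NEVER «G-an2-4 closed» as
(CONV-C); NOT D1, NOT BetaPertH, NOT continuum, NOT Clay.  2026-08-22; no existing file touched.
-/

noncomputable section

open Finset
open scoped BigOperators
open Literature.MathematicalPhysics.QuantumFieldTheory
open Literature.MathematicalPhysics.QuantumFieldTheory.Balaban1983to89
open Literature.MathematicalPhysics.QuantumFieldTheory.Balaban1983to89.Beta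
open B12Sec2to5 (l1 l1_nonneg)
open B6BondElimination (unitVec)
open ExpKernelCalculus (Site MKer BiLoc VertexFamily Zl summable_exp_shift' l1_sub_triangle l1_sub_symm)
open AffineAveraging (box toSite)
open AveragingContours (blk)
open AxialProjector (blk_zsmul)
open OneStepResolventKernel (Fib LocStencil)
open Summit.QuantumFields.BalabanUV.Beta.KernelWardRelative (gaugeWt)
open Summit.QuantumFields.BalabanUV.Beta.GAN24.Lin4LegDivergence (tsum_mul_gaugeWt_eq_boxSum)
open Summit.QuantumFields.BalabanUV.Beta.GAN24.GaugeReadLayerForm (boxSum_sub_shift_eq_zero_of_periodic)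
open Summit.QuantumFields.BalabanUV.Beta.GAN24.GaugeReadChargeDipole (abs_tsum_prod_le_of_biLoc)
open Summit.QuantumFields.BalabanUV.Beta.GAN24.GaugeReadChargeProfile (biLoc_weightMul hasSum_weightedGaugeCharge_mass)

namespace Summit.QuantumFields.BalabanUV.Beta.GAN24.GaugeReadChargeMass

variable {d : ℕ}

/-! ## §1 Slot sums of bi-localised families -/

/-- [folklore] A Gaussian centred at a fine point `x` is summable over the COARSE lattice: `w ↦ e^{−c‖N•w − x‖₁}` (`1 ≤ N`, `c > 0`; `w ↦ N•w` is injective). -/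
theorem summable_coarseGauss {N : ℕ} (hN : 1 ≤ N) {c : ℝ} (hc : 0 < c) (x : Site (d + 1)) :
    Summable fun w : Site (d + 1) => Real.exp (-c * l1 ((N : ℤ) • w - x)) := by
  have hinj : Function.Injective (fun w : Site (d + 1) => (N : ℤ) • w) :=
    Function.LeftInverse.injective (g := blk N) (blk_zsmul hN)
  exact (summable_exp_shift' hc x).comp_injective hinj

/-- [folklore] **THE SLOT SUM OF A BI-LOCALISED FAMILY**: if `|E y′| ≤ CA·e^{−δ(‖p − N•y′‖₁ + ‖x − N•y′‖₁)}` for every slot `y′` (`δ > 0`, `1 ≤ N`), then `y′ ↦ E y′` is summable and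
`|Σ'_{y′} E y′| ≤ CA·e^{−(δ∕2)‖p − x‖₁}·Σ'_{y′} e^{−(δ∕2)‖x − N•y′‖₁}` (triangle inequality through `N•y′`; half the rate pays the off-diagonal decay, half stays summable). -/
theorem summable_slotSum_and_abs_le {N : ℕ} (hN : 1 ≤ N) {E : Site (d + 1) → ℝ} {CA δ : ℝ} (hδ : 0 < δ) {p x : Site (d + 1)}
    (hE : ∀ y', |E y'| ≤ CA * Real.exp (-δ * (l1 (p - (N : ℤ) • y') + l1 (x - (N : ℤ) • y')))) :
    Summable E ∧ |∑' y', E y'| ≤ CA * Real.exp (-(δ / 2) * l1 (p - x)) * ∑' y' : Site (d + 1), Real.exp (-(δ / 2) * l1 (x - (N : ℤ) • y')) := by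
  have hG : Summable fun y' : Site (d + 1) => Real.exp (-(δ / 2) * l1 (x - (N : ℤ) • y')) :=
    (summable_coarseGauss hN (half_pos hδ) x).congr fun w => by rw [l1_sub_symm]
  have hC : 0 ≤ CA := by
    have h0 := (abs_nonneg _).trans (hE 0)
    have he := Real.exp_pos (-δ * (l1 (p - (N : ℤ) • (0 : Site (d + 1))) + l1 (x - (N : ℤ) • (0 : Site (d + 1)))))
    nlinarith
  have hpt : ∀ y', |E y'| ≤ CA * Real.exp (-(δ / 2) * l1 (p - x)) * Real.exp (-(δ / 2) * l1 (x - (N : ℤ) • y')) := by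
    intro y'
    have ht : l1 (p - x) ≤ l1 (p - (N : ℤ) • y') + l1 (x - (N : ℤ) • y') := by
      rw [l1_sub_symm x]; exact l1_sub_triangle _ _ _
    have h0 : 0 ≤ l1 (p - (N : ℤ) • y') := l1_nonneg _
    refine (hE y').trans ?_
    rw [mul_assoc, ← Real.exp_add]
    refine mul_le_mul_of_nonneg_left (Real.exp_le_exp.2 ?_) hC
    nlinarith
  refine ⟨Summable.of_norm_bounded (hG.mul_left _) (fun y' => by rw [Real.norm_eq_abs]; exact hpt y'), ?_⟩
  have h := tsum_of_norm_bounded (hG.hasSum.mul_left (CA * Real.exp (-(δ / 2) * l1 (p - x)))) (fun y' => by rw [Real.norm_eq_abs]; exact hpt y')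
  rw [Real.norm_eq_abs] at h
  exact h

/-! ## §2 The generic mechanism: the slot-summed response read of a block-covariant family against a block-periodic slot function vanishes -/

/-- NOT IN PRINT; OUR BOOKKEEPING.  **THE SLOT-SUMMED READ AGAINST THE LABEL's GAUGE WEIGHT, PAIRED WITH A BLOCK-PERIODIC SLOT FUNCTION, IS ZERO.**  Data: `1 ≤ N`, `δ > 0`;
a scalar family `E y′ u κ₂ x` (slot `y′`, stencil index `u`, fine position `x`, column `κ₂`) dominated by `CA·e^{−δ(‖π u − N•y′‖₁ + ‖x − N•y′‖₁)}` with `u ↦ e^{−(δ∕2)‖π u − x‖₁}`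
summable for every `x`; a family of bijections `τ_s` of the stencil index with the JOINT COVARIANCE `E (y′ + s) (τ_s u) κ₂ (x + N•s) = E y′ u κ₂ x`; a bounded slot function `Z`
with `Z (τ_s u) = Z u`.  Then for every label `y`:  `Σ'_u (Σ'_{y′} Σ'_x Σ_κ₂ E y′ u κ₂ x·gaugeWt N y κ₂ x)·Z u = 0`.
MECHANISM: the read is a finite box sum of backward differences (`tsum_mul_gaugeWt_eq_boxSum`); after the slot sum and the `u`-sum the profile
`H κ₂ x := Σ'_u (Σ'_{y′} E y′ u κ₂ x)·Z u` is `N`-periodic in `x` (reindex `u ↦ τ_s u`, `y′ ↦ y′ + s`); `boxSum_sub_shift_eq_zero_of_periodic` closes. -/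
theorem tsum_slotSummedRead_mul_eq_zero {N : ℕ} (hN : 1 ≤ N) {E : Site (d + 1) → Site (d + 1) → Fin (d + 1) → Site (d + 1) → ℝ} {CA δ : ℝ} (hδ : 0 < δ)
    (π : Site (d + 1) → Site (d + 1))
    (hEb : ∀ y' u κ₂ x, |E y' u κ₂ x| ≤ CA * Real.exp (-δ * (l1 (π u - (N : ℤ) • y') + l1 (x - (N : ℤ) • y'))))
    (hπ : ∀ x, Summable fun u => Real.exp (-(δ / 2) * l1 (π u - x)))
    (τ : Site (d + 1) → Site (d + 1) ≃ Site (d + 1)) (hEcov : ∀ y' s u κ₂ x, E (y' + s) (τ s u) κ₂ (x + (N : ℤ) • s) = E y' u κ₂ x)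
    {Z : Site (d + 1) → ℝ} {bZ : ℝ} (hZb : ∀ u, |Z u| ≤ bZ) (hZcov : ∀ s u, Z (τ s u) = Z u) (y : Site (d + 1)) :
    ∑' u, (∑' y', ∑' x, ∑ κ₂, E y' u κ₂ x * gaugeWt N y κ₂ x) * Z u = 0 := by
  -- the slot sums `Ā u κ₂ x := Σ'_{y′} E y′ u κ₂ x`: summable, and decaying in `‖π u − x‖₁`
  have h2 : ∀ u κ₂ x, Summable (fun y' => E y' u κ₂ x) ∧
      |∑' y', E y' u κ₂ x| ≤ CA * Real.exp (-(δ / 2) * l1 (π u - x)) * ∑' y' : Site (d + 1), Real.exp (-(δ / 2) * l1 (x - (N : ℤ) • y')) :=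
    fun u κ₂ x => summable_slotSum_and_abs_le hN hδ (fun y' => hEb y' u κ₂ x)
  -- Step 1+2: the slot-summed read is a finite box sum of differences of slot sums
  have h3 : ∀ u, ∑' y', ∑' x, ∑ κ₂, E y' u κ₂ x * gaugeWt N y κ₂ x
      = ∑ v ∈ box (d + 1) N, ∑ κ₂, ((∑' y', E y' u κ₂ ((N : ℤ) • y + toSite v - unitVec κ₂)) - ∑' y', E y' u κ₂ ((N : ℤ) • y + toSite v)) := by
    intro u
    have e : (fun y' => ∑' x, ∑ κ₂, E y' u κ₂ x * gaugeWt N y κ₂ x)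
        = fun y' => ∑ v ∈ box (d + 1) N, ∑ κ₂, (E y' u κ₂ ((N : ℤ) • y + toSite v - unitVec κ₂) - E y' u κ₂ ((N : ℤ) • y + toSite v)) :=
      funext fun y' => tsum_mul_gaugeWt_eq_boxSum hN (E y' u) y
    rw [e, Summable.tsum_finsetSum (fun v _ => summable_sum fun κ₂ _ => (h2 u κ₂ _).1.sub (h2 u κ₂ _).1)]
    refine Finset.sum_congr rfl fun v _ => ?_
    rw [Summable.tsum_finsetSum (fun κ₂ _ => (h2 u κ₂ _).1.sub (h2 u κ₂ _).1)]
    exact Finset.sum_congr rfl fun κ₂ _ => (h2 u κ₂ _).1.tsum_sub (h2 u κ₂ _).1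
  -- Step 3: `u ↦ Ā u κ₂ x · Z u` is summable for every `x`
  have h4 : ∀ κ₂ x, Summable fun u => (∑' y', E y' u κ₂ x) * Z u := by
    intro κ₂ x
    set Y : ℝ := ∑' y' : Site (d + 1), Real.exp (-(δ / 2) * l1 (x - (N : ℤ) • y')) with hY
    refine Summable.of_norm_bounded ((hπ x).mul_left (CA * Y * bZ)) (fun u => ?_)
    rw [Real.norm_eq_abs, abs_mul]
    have hb := (h2 u κ₂ x).2
    have h0 : 0 ≤ CA * Real.exp (-(δ / 2) * l1 (π u - x)) * Y := (abs_nonneg _).trans hb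
    calc |∑' y', E y' u κ₂ x| * |Z u| ≤ (CA * Real.exp (-(δ / 2) * l1 (π u - x)) * Y) * bZ := mul_le_mul hb (hZb u) (abs_nonneg _) h0
      _ = CA * Y * bZ * Real.exp (-(δ / 2) * l1 (π u - x)) := by ring
  -- Step 4: the profile `H κ₂ x := Σ'_u Ā u κ₂ x · Z u` is `N`-periodic in every direction
  have hH : ∀ κ₂ (s x : Site (d + 1)), ∑' u, (∑' y', E y' u κ₂ (x + (N : ℤ) • s)) * Z u = ∑' u, (∑' y', E y' u κ₂ x) * Z u := by
    intro κ₂ s x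
    rw [← Equiv.tsum_eq (τ s) (fun u => (∑' y', E y' u κ₂ (x + (N : ℤ) • s)) * Z u)]
    refine tsum_congr fun u => ?_
    rw [hZcov s u, ← Equiv.tsum_eq (Equiv.addRight s) (fun y' => E y' (τ s u) κ₂ (x + (N : ℤ) • s))]
    simp only [Equiv.coe_addRight, hEcov]
  -- assemble
  calc ∑' u, (∑' y', ∑' x, ∑ κ₂, E y' u κ₂ x * gaugeWt N y κ₂ x) * Z u
      = ∑' u, ∑ v ∈ box (d + 1) N, ∑ κ₂, ((∑' y', E y' u κ₂ ((N : ℤ) • y + toSite v - unitVec κ₂)) * Z u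
          - (∑' y', E y' u κ₂ ((N : ℤ) • y + toSite v)) * Z u) := by
        refine tsum_congr fun u => ?_
        rw [h3 u, Finset.sum_mul]
        exact Finset.sum_congr rfl fun v _ => by rw [Finset.sum_mul]; exact Finset.sum_congr rfl fun κ₂ _ => by ring
    _ = ∑ v ∈ box (d + 1) N, ∑ κ₂, ((∑' u, (∑' y', E y' u κ₂ ((N : ℤ) • y + toSite v - unitVec κ₂)) * Z u)
          - ∑' u, (∑' y', E y' u κ₂ ((N : ℤ) • y + toSite v)) * Z u) := by
        rw [Summable.tsum_finsetSum (fun v _ => summable_sum fun κ₂ _ => (h4 κ₂ _).sub (h4 κ₂ _))]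
        refine Finset.sum_congr rfl fun v _ => ?_
        rw [Summable.tsum_finsetSum (fun κ₂ _ => (h4 κ₂ _).sub (h4 κ₂ _))]
        exact Finset.sum_congr rfl fun κ₂ _ => (h4 κ₂ _).tsum_sub (h4 κ₂ _)
    _ = ∑ κ₂, ∑ v ∈ box (d + 1) N, ((∑' u, (∑' y', E y' u κ₂ ((N : ℤ) • y + toSite v - unitVec κ₂)) * Z u)
          - ∑' u, (∑' y', E y' u κ₂ ((N : ℤ) • y + toSite v)) * Z u) := Finset.sum_comm
    _ = 0 := Finset.sum_eq_zero fun κ₂ _ =>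
        boxSum_sub_shift_eq_zero_of_periodic hN (f := fun x => ∑' u, (∑' y', E y' u κ₂ x) * Z u) (fun x => hH κ₂ (unitVec κ₂) x) y

/-! ## §3 (M0)_γ: the slot-summed (γ) ω-charge vanishes under block covariance -/

/-- NOT IN PRINT; OUR BOOKKEEPING.  **(M0)_γ BY BLOCK COVARIANCE.**  In the SETTING of `GaugeReadChargeProfile` (`1 ≤ N`, `VertexFamily A N CA δ`, `LocStencil S Cs δ`,
`VertexFamily M N CM δ`, `δ > 0`, label `y`, slot direction `ν`, channel `(a,b)`, `|ω| ≤ B`), ASSUME (COV) the response kernels of the multiplier slots are jointly block-translation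
covariant, `A ν (y′ + s) (u + N•s) (x + N•s) r c = A ν y′ u x r c`, and (PER) the tables' ω-charges are block-periodic, `Z_ω(S κ (u + N•s)) = Z_ω(S κ u)`, `Z_ω(M ρ (w + s)) = Z_ω(M ρ w)`.
THEN the (γ) ω-charge profile has ZERO MASS: `HasSum (y′ ↦ Q_ω(y′)) 0` — the `hm` socket of `SlotMomentParity.hasSum_moments_sum` for the (γ) piece with value `0` (the (γ) twin of
road-P2's (M0) for (α)).  The value of `GaugeReadChargeProfile.hasSum_weightedGaugeCharge_mass` is killed summand by summand by §2 (fine: `π = id`, `τ_s = (· + N•s)`; coarse: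
`π = (N•·)`, `τ_s = (· + s)`).  (COV)∕(PER) stay DISPLAYED; NO (Π), NOTHING of (INV) claimed. -/
theorem hasSum_weightedGaugeCharge_mass_zero {N : ℕ} (hN : 1 ≤ N) {A : Fin (d + 1) → Site (d + 1) → MKer (d + 1) (Fib d)} {CA δ : ℝ}
    (hA : VertexFamily A N CA δ) (hδ : 0 < δ)
    {S : Fin (d + 1) → Site (d + 1) → MKer (d + 1) (Fib d)} {Cs : ℝ} (hS : LocStencil S Cs δ)
    {M : Fin (d + 1) → Site (d + 1) → MKer (d + 1) (Fib d)} {CM : ℝ} (hM : VertexFamily M N CM δ)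
    (y : Site (d + 1)) (ν : Fin (d + 1)) (a b : Fib d) {ω : Site (d + 1) × Site (d + 1) → ℝ} {B : ℝ} (hω : ∀ xz, |ω xz| ≤ B)
    (hAcov : ∀ (y' s u x : Site (d + 1)) (r c : Fib d), A ν (y' + s) (u + (N : ℤ) • s) (x + (N : ℤ) • s) r c = A ν y' u x r c)
    (hZS : ∀ (κ : Fin (d + 1)) (u s : Site (d + 1)),
      ∑' xz : Site (d + 1) × Site (d + 1), ω xz * S κ (u + (N : ℤ) • s) xz.1 xz.2 a b = ∑' xz : Site (d + 1) × Site (d + 1), ω xz * S κ u xz.1 xz.2 a b)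
    (hZM : ∀ (ρ : Fin (d + 1)) (w s : Site (d + 1)),
      ∑' xz : Site (d + 1) × Site (d + 1), ω xz * M ρ (w + s) xz.1 xz.2 a b = ∑' xz : Site (d + 1) × Site (d + 1), ω xz * M ρ w xz.1 xz.2 a b) :
    HasSum (fun y' : Site (d + 1) =>
        ∑ κ, ∑' u, (∑' x₂, ∑ κ₂, A ν y' u x₂ (Sum.inl κ) (Sum.inl κ₂) * gaugeWt N y κ₂ x₂) *
              ∑' xz : Site (d + 1) × Site (d + 1), ω xz * S κ u xz.1 xz.2 a b
          + ∑ ρ, ∑' w, (∑' x₂, ∑ κ₂, A ν y' ((N : ℤ) • w) x₂ (Sum.inr ρ) (Sum.inl κ₂) * gaugeWt N y κ₂ x₂) *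
              ∑' xz : Site (d + 1) × Site (d + 1), ω xz * M ρ w xz.1 xz.2 a b) 0 := by
  have h := hasSum_weightedGaugeCharge_mass hN hA hδ hS hM y ν a b hω
  -- fine summands: `π = id`, `τ_s = (· + N•s)`
  have hF : ∀ κ : Fin (d + 1), ∑' u, (∑' y' : Site (d + 1), ∑' x₂, ∑ κ₂, A ν y' u x₂ (Sum.inl κ) (Sum.inl κ₂) * gaugeWt N y κ₂ x₂) *
      ∑' xz : Site (d + 1) × Site (d + 1), ω xz * S κ u xz.1 xz.2 a b = 0 := by
    intro κ
    exact tsum_slotSummedRead_mul_eq_zero hN (E := fun y' u κ₂ x => A ν y' u x (Sum.inl κ) (Sum.inl κ₂)) hδ (fun u => u)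
      (fun y' u κ₂ x => hA ν y' u x (Sum.inl κ) (Sum.inl κ₂)) (fun x => summable_exp_shift' (half_pos hδ) x)
      (fun s => Equiv.addRight ((N : ℤ) • s)) (fun y' s u κ₂ x => by rw [Equiv.coe_addRight]; exact hAcov y' s u x _ _)
      (fun u => abs_tsum_prod_le_of_biLoc (biLoc_weightMul (hS κ u) hω) hδ a b) (fun s u => by rw [Equiv.coe_addRight]; exact hZS κ u s) y
  -- coarse summands: `π = (N•·)`, `τ_s = (· + s)`
  have hC : ∀ ρ : Fin (d + 1), ∑' w, (∑' y' : Site (d + 1), ∑' x₂, ∑ κ₂, A ν y' ((N : ℤ) • w) x₂ (Sum.inr ρ) (Sum.inl κ₂) * gaugeWt N y κ₂ x₂) *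
      ∑' xz : Site (d + 1) × Site (d + 1), ω xz * M ρ w xz.1 xz.2 a b = 0 := by
    intro ρ
    exact tsum_slotSummedRead_mul_eq_zero hN (E := fun y' w κ₂ x => A ν y' ((N : ℤ) • w) x (Sum.inr ρ) (Sum.inl κ₂)) hδ (fun w => (N : ℤ) • w)
      (fun y' w κ₂ x => hA ν y' ((N : ℤ) • w) x (Sum.inr ρ) (Sum.inl κ₂)) (fun x => summable_coarseGauss hN (half_pos hδ) x)
      (fun s => Equiv.addRight s) (fun y' s w κ₂ x => by rw [Equiv.coe_addRight, smul_add]; exact hAcov y' s ((N : ℤ) • w) x _ _)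
      (fun w => abs_tsum_prod_le_of_biLoc (biLoc_weightMul (hM ρ w) hω) hδ a b) (fun s w => by rw [Equiv.coe_addRight]; exact hZM ρ w s) y
  have hv : (∑ κ, ∑' u, (∑' y' : Site (d + 1), ∑' x₂, ∑ κ₂, A ν y' u x₂ (Sum.inl κ) (Sum.inl κ₂) * gaugeWt N y κ₂ x₂) *
            ∑' xz : Site (d + 1) × Site (d + 1), ω xz * S κ u xz.1 xz.2 a b
        + ∑ ρ, ∑' w, (∑' y' : Site (d + 1), ∑' x₂, ∑ κ₂, A ν y' ((N : ℤ) • w) x₂ (Sum.inr ρ) (Sum.inl κ₂) * gaugeWt N y κ₂ x₂) *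
            ∑' xz : Site (d + 1) × Site (d + 1), ω xz * M ρ w xz.1 xz.2 a b) = 0 := by
    rw [Finset.sum_eq_zero fun κ _ => hF κ, Finset.sum_eq_zero fun ρ _ => hC ρ, add_zero]
  rwa [hv] at h

/-- NOT IN PRINT; OUR BOOKKEEPING.  **(M0)_γ IN THE PLAIN CURRENCY** (`ω ≡ 1`): under (COV) and the block-periodicity of the plain pair charges
`Σ'_{(x,z)} S κ (u + N•s) x z a b = Σ'_{(x,z)} S κ u x z a b`, `Σ'_{(x,z)} M ρ (w + s) x z a b = Σ'_{(x,z)} M ρ w x z a b`, the plain (γ) slot-charge profile of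
`GaugeReadChargeDipole.hasSum_slotMoment_gaugeCharge` has ZERO MASS: `HasSum (y′ ↦ Q(y′)) 0`. -/
theorem hasSum_gaugeCharge_mass_zero {N : ℕ} (hN : 1 ≤ N) {A : Fin (d + 1) → Site (d + 1) → MKer (d + 1) (Fib d)} {CA δ : ℝ}
    (hA : VertexFamily A N CA δ) (hδ : 0 < δ)
    {S : Fin (d + 1) → Site (d + 1) → MKer (d + 1) (Fib d)} {Cs : ℝ} (hS : LocStencil S Cs δ)
    {M : Fin (d + 1) → Site (d + 1) → MKer (d + 1) (Fib d)} {CM : ℝ} (hM : VertexFamily M N CM δ)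
    (y : Site (d + 1)) (ν : Fin (d + 1)) (a b : Fib d)
    (hAcov : ∀ (y' s u x : Site (d + 1)) (r c : Fib d), A ν (y' + s) (u + (N : ℤ) • s) (x + (N : ℤ) • s) r c = A ν y' u x r c)
    (hZS : ∀ (κ : Fin (d + 1)) (u s : Site (d + 1)),
      ∑' xz : Site (d + 1) × Site (d + 1), S κ (u + (N : ℤ) • s) xz.1 xz.2 a b = ∑' xz : Site (d + 1) × Site (d + 1), S κ u xz.1 xz.2 a b)
    (hZM : ∀ (ρ : Fin (d + 1)) (w s : Site (d + 1)),
      ∑' xz : Site (d + 1) × Site (d + 1), M ρ (w + s) xz.1 xz.2 a b = ∑' xz : Site (d + 1) × Site (d + 1), M ρ w xz.1 xz.2 a b) :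
    HasSum (fun y' : Site (d + 1) =>
        ∑ κ, ∑' u, (∑' x₂, ∑ κ₂, A ν y' u x₂ (Sum.inl κ) (Sum.inl κ₂) * gaugeWt N y κ₂ x₂) *
              ∑' xz : Site (d + 1) × Site (d + 1), S κ u xz.1 xz.2 a b
          + ∑ ρ, ∑' w, (∑' x₂, ∑ κ₂, A ν y' ((N : ℤ) • w) x₂ (Sum.inr ρ) (Sum.inl κ₂) * gaugeWt N y κ₂ x₂) *
              ∑' xz : Site (d + 1) × Site (d + 1), M ρ w xz.1 xz.2 a b) 0 := by
  have h := hasSum_weightedGaugeCharge_mass_zero hN hA hδ hS hM y ν a b (ω := fun _ => (1 : ℝ)) (B := 1) (fun _ => by rw [abs_one]) hAcov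
    (fun κ u s => by simpa only [one_mul] using hZS κ u s) (fun ρ w s => by simpa only [one_mul] using hZM ρ w s)
  simp only [one_mul] at h
  exact h

end Summit.QuantumFields.BalabanUV.Beta.GAN24.GaugeReadChargeMass

end
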